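import Literature.Analysis.FluidPDE.SeisDissipationRateBound
import Literature.Analysis.FluidPDE.SeisSliceIncrement
import Literature.Analysis.FluidPDE.SeisTimeChain
import Literature.Analysis.FunctionSpaces.KantorovichSobolevInterpolation
import Literature.Analysis.FunctionSpaces.TorusTranslationModulusL1
import Literature.Analysis.FunctionSpaces.TorusPoincareMorrey
import HarnessLib

/-!
# Seis 2022, Thm. 2 / Rmk. 1 (`p = q = r = 2`): proof of the dissipation-rate bound

Analysis/FluidPDE proofs file: it **discharges** the named facts
`Literature.Analysis.FluidPDE.Seis2022_rmk1_L2` (`Seis2022_rmk1_L2_holds`) and, as its special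
case `M = 1`, `Literature.Analysis.FluidPDE.Seis2022_thm2_L2` (`Seis2022_thm2_L2_holds`) of
`SeisDissipationRateBound` (Seis, *Bounds on the rate of enhanced dissipation*, Comm. Math. Phys.
399 (2023) = arXiv:2003.08794, Thm. 2 and Rmk. 1).

The printed proof (§2.2) runs on the logarithmic Kantorovich–Rubinstein distance `D_δ` (here
the dual `Torus.krLogDist`, `KantorovichLogDistance`), Lemma 3 (rate of change of `D_δ` along
the advection–diffusion equation) and Lemma 4 (Kantorovich–Sobolev interpolation,
`KantorovichSobolevInterpolation`), telescoped over the dissipation time scale with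
`δ = √κ`. The tree's proof follows it with two deviations forced by the weak setting
("every weak solution in `L^∞_t L²_x`", velocity only in `L^∞_t L²_x` with `∫₀ᵗ‖∇u‖₂ ≤ M(1+t)`):

* the density is regularised in space, `ρ_t = θ(t) ⋆ k_δ` (torus mollifier at the scale `δ`),
  whose time primitive is the flux identity of `PassiveScalarEnergyMollified`; Lemma 3 is
  replaced by the slice increment bound of `SeisSliceIncrement` (transport inequality for the
  optimal potential — the dual of the plan estimate —, DiPerna–Lions commutator, and the
  diffusive term paid as `κ ∫|θ| · sup|Δ(ζ ⋆ k_δ)| ≲ (κ/δ²)‖θ‖₁ = ‖θ‖₁`, so that **no energy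
  inequality / regularity of `θ` is needed**);
* the time integration is the chain over good times of `SeisTimeChain` (mesh `→ 0` kills the
  mismatch term), started at a good time near `0` (sup-norm continuity of `krLogDist`).

Endpoints: `krLogDist δ (θ₀ ⋆ k_δ) ≳ a log(1/δ)` by Lemma 4 (`‖θ₀ ⋆ k_δ‖₁ ≥ a/2`, translation
modulus `≤ √d ‖∇θ₀‖₁`), `krLogDist δ (θ(τ) ⋆ k_δ) ≤ log(1/δ) C₀ e^{-Dτ}` (brutal estimate) at a
good `τ ≥ N/D`; with `δ = √κ` this gives `a log(1/κ) ≲ (1 + M)/D`, i.e. `D ≤ K / log(1/κ)`, after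
the reduction to `D ≤ 1` (for `D > 1` the hypothesis holds with rate `1`, contradicting
`log(1/κ₀) > K`). All constants are explicit functions of `d, a, B, C₀, M` (and do not depend on
the upper bound `b` of `‖θ₀‖₁`, which the printed proof does not use either).

## References

* C. Seis, Comm. Math. Phys. 399 (2023) 2071–2081 = arXiv:2003.08794: Thm. 2 (pp. 3–4), Rmk. 1
  (p. 4), §2.2 (pp. 6–8). [`Seis2022`]
-/

noncomputable section

open MeasureTheory Set Filter Metric Function Topology
open scoped ENNReal NNReal Topology InnerProductSpace Convolution
open Literature.Analysis.FunctionSpaces Literature.Analysis.FunctionSpaces.Torus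
open Literature.Analysis.SingularIntegrals Literature.Analysis.SingularIntegrals.Torus

namespace Literature.Analysis.FluidPDE

variable {d : Type*} [Fintype d] [DecidableEq d]

/-! ## Translation modulus of smooth data and of their mollifications -/

omit [DecidableEq d] in
/-- Translation commutes with mollification: `(θ ⋆ k)(x - y) = (θ(· - y) ⋆ k)(x)`. [folklore] -/
theorem convolution_sub_eq_translate_convolution {θ : UnitAddTorus d → ℝ} {k : UnitAddTorus d → ℝ}
    (x y : UnitAddTorus d) : (θ ⋆ k) (x - y) = ((fun z => θ (z - y)) ⋆ k) x := by
  rw [convolution_lsmul, convolution_lsmul]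
  have := integral_add_right_eq_self (μ := (volume : Measure (UnitAddTorus d)))
    (fun t => θ (t - y) • k (x - t)) y
  rw [← this]
  refine integral_congr_ae (Eventually.of_forall fun t => ?_)
  show θ t • k (x - y - t) = θ (t + y - y) • k (x - (t + y))
  rw [add_sub_cancel_right, sub_add_eq_sub_sub, sub_right_comm]

omit [DecidableEq d] in
/-- **The `L¹` translation modulus does not increase under mollification**:
`‖(θ ⋆ k_ε)(· - y) - θ ⋆ k_ε‖_{L¹} ≤ ‖θ(· - y) - θ‖_{L¹}` (Young, `∫ k_ε = 1`). [folklore] -/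
theorem eLpNorm_sub_translate_convolution_kernel_le {θ : UnitAddTorus d → ℝ} (hθ : Integrable θ volume)
    {ε : ℝ} (hε : 0 < ε) (hε' : ε ≤ 1 / 4) (y : UnitAddTorus d) :
    eLpNorm (fun x => (θ ⋆ kernel ε) (x - y) - (θ ⋆ kernel ε) x) 1 volume ≤
      eLpNorm (fun x => θ (x - y) - θ x) 1 volume := by
  have hk := continuous_kernel (d := d) hε hε'
  have hθy : Integrable (fun z => θ (z - y)) volume := hθ.comp_sub_right y
  have e : (fun x => (θ ⋆ kernel ε) (x - y) - (θ ⋆ kernel ε) x) = ((fun z => θ (z - y)) - θ) ⋆ kernel ε := by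
    rw [sub_convolution hθy hθ hk]
    funext x
    simp only [Pi.sub_apply, convolution_sub_eq_translate_convolution x y]
  rw [e]
  refine (eLpNorm_convolution_le (hθy.sub hθ).aestronglyMeasurable hk.aestronglyMeasurable le_rfl).trans ?_
  rw [lintegral_enorm_kernel hε hε', one_mul]
  rfl

/-! ## Measurability in time of the spectral enstrophy of the slices -/

omit [DecidableEq d] in
/-- For a jointly measurable field, `t ↦ eGradNormSq (u t)` is a.e.-measurable in time (each
Fourier coefficient is a fibre integral of a jointly measurable function; countable sum). [folklore] -/
theorem aemeasurable_eGradNormSq_slice {μ : Measure ℝ} [SFinite μ]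
    {u : ℝ → UnitAddTorus d → EuclideanSpace ℝ d} (hu : AEStronglyMeasurable (uncurry u) (μ.prod volume)) :
    AEMeasurable (fun t => eGradNormSq (u t)) μ := by
  have hcoef : ∀ k : d → ℤ, AEStronglyMeasurable
      (fun t => UnitAddTorus.mFourierCoeff (EuclideanSpace.complexify ∘ u t) k) μ := fun k => by
    have hF : AEStronglyMeasurable (fun z : ℝ × UnitAddTorus d =>
        (UnitAddTorus.mFourier (-k) z.2 : ℂ) • EuclideanSpace.complexify (u z.1 z.2)) (μ.prod volume) :=
      ((UnitAddTorus.mFourier (-k)).continuous.aestronglyMeasurable.comp_snd).smul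
        (EuclideanSpace.complexify.continuous.comp_aestronglyMeasurable hu)
    have e : (fun t => UnitAddTorus.mFourierCoeff (EuclideanSpace.complexify ∘ u t) k) =
        fun t => ∫ y, (UnitAddTorus.mFourier (-k) y : ℂ) • (EuclideanSpace.complexify ∘ u t) y :=
      funext fun t => mFourierCoeff_eq_integral_volume _ _
    rw [e]
    exact hF.integral_prod_right'
  have h : (fun t => eGradNormSq (u t)) = fun t => ENNReal.ofReal (4 * Real.pi ^ 2) *
      ∑' k : d → ℤ, ENNReal.ofReal (freqNormSq k) * ‖UnitAddTorus.mFourierCoeff (EuclideanSpace.complexify ∘ u t) k‖ₑ ^ 2 :=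
    funext fun t => eGradNormSq_eq_tsum (u t)
  rw [h]
  exact (AEMeasurable.tsum fun k => ((hcoef k).enorm.pow_const 2).const_mul _).const_mul _

/-! ## Small torus-calculus facts -/

omit [DecidableEq d] in
/-- The gradient of a constant vanishes. [folklore] -/
private theorem torusGradient_const (c : ℝ) (z : UnitAddTorus d) : Torus.gradient (fun _ : UnitAddTorus d => c) z = 0 := by
  show _root_.gradient (liftAt (fun _ : UnitAddTorus d => c) z) 0 = 0
  have e : liftAt (fun _ : UnitAddTorus d => c) z = fun _ => c := rfl
  rw [e]
  simp [_root_.gradient]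

omit [DecidableEq d] in
/-- The Laplacian of a constant vanishes. [folklore] -/
private theorem torusLaplacian_const (c : ℝ) (z : UnitAddTorus d) : Torus.laplacian (fun _ : UnitAddTorus d => c) z = 0 := by
  have h := congrFun (InnerProductSpace.laplacian_eq_iteratedFDeriv_orthonormalBasis
    (liftAt (fun _ : UnitAddTorus d => c) z) (EuclideanSpace.basisFun d ℝ)) 0
  rw [Torus.laplacian, h]
  have e : liftAt (fun _ : UnitAddTorus d => c) z = fun _ => c := rfl
  simp [e, iteratedFDeriv_const_of_ne two_ne_zero]

omit [DecidableEq d] in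
/-- The mollification as the `molInt` of `PassiveScalarEnergyMollified`: `(θ ⋆ k) x = ∫ θ y k(x-y) dy`. [folklore] -/
theorem convolution_eq_molInt (θ k : UnitAddTorus d → ℝ) (x : UnitAddTorus d) :
    (θ ⋆ k) x = ∫ y, θ y * k (x - y) := by
  rw [convolution_lsmul]; rfl

omit [DecidableEq d] in
/-- `∫ |f| ≤ √(∫ f²)` on the probability space `T^d` for `f ∈ L²`. [folklore] -/
theorem integral_abs_le_sqrt_integral_sq {f : UnitAddTorus d → ℝ} (hf : MemLp f 2 volume) :
    ∫ x, |f x| ≤ Real.sqrt (∫ x, f x ^ 2) := by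
  have h := integral_mul_le_Lp_mul_Lq_of_nonneg Real.HolderConjugate.two_two
    (f := fun x => |f x|) (g := fun _ => (1 : ℝ))
    (Eventually.of_forall fun x => abs_nonneg _) (Eventually.of_forall fun x => zero_le_one)
    (by rw [ENNReal.ofReal_ofNat]; exact hf.abs) (by rw [ENNReal.ofReal_ofNat]; exact memLp_const _)
  simp only [mul_one, Real.rpow_two, sq_abs, one_pow, integral_const, smul_eq_mul] at h
  rw [← Real.sqrt_eq_rpow] at h
  simpa using h

omit [DecidableEq d] in
/-- `∫ ‖u‖ ≤ √Mv` when `∫⁻ ‖u‖ₑ² ≤ ofReal Mv` (`L¹ ≤ L²` on a probability space). [folklore] -/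
theorem integral_norm_le_sqrt_of_lintegral_sq_le {u : UnitAddTorus d → EuclideanSpace ℝ d}
    (hu : MemLp u 2 volume) {Mv : ℝ} (hMv : 0 ≤ Mv) (h : ∫⁻ x, ‖u x‖ₑ ^ 2 ≤ ENNReal.ofReal Mv) :
    ∫ x, ‖u x‖ ≤ Real.sqrt Mv := by
  have h1 : ∫ x, ‖u x‖ ≤ Real.sqrt (∫ x, ‖u x‖ ^ 2) := by
    have := integral_abs_le_sqrt_integral_sq hu.norm
    simpa [abs_norm] using this
  refine h1.trans (Real.sqrt_le_sqrt ?_)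
  have hfin : ∫⁻ x, ‖u x‖ₑ ^ 2 ≠ ∞ := (lt_of_le_of_lt h ENNReal.ofReal_lt_top).ne
  have e : ∫ x, ‖u x‖ ^ 2 = (∫⁻ x, ‖u x‖ₑ ^ 2).toReal := by
    rw [integral_eq_lintegral_of_nonneg_ae (Eventually.of_forall fun x => sq_nonneg _)
      (hu.1.norm.aemeasurable.pow_const 2).aestronglyMeasurable]
    congr 1
    exact lintegral_congr fun x => by rw [ENNReal.ofReal_pow (norm_nonneg _), ofReal_norm]
  rw [e]
  exact (ENNReal.toReal_mono ENNReal.ofReal_ne_top h).trans (by rw [ENNReal.toReal_ofReal hMv])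

omit [DecidableEq d] in
/-- Young in `L²` for the mollifier, real form: `√(∫ (θ ⋆ k_ε)²) ≤ √(∫ θ²)`. [folklore] -/
theorem sqrt_integral_sq_convolution_kernel_le {θ : UnitAddTorus d → ℝ} (hθ : MemLp θ 2 volume)
    {ε : ℝ} (hε : 0 < ε) (hε' : ε ≤ 1 / 4) :
    Real.sqrt (∫ x, (θ ⋆ kernel ε) x ^ 2) ≤ Real.sqrt (∫ x, θ x ^ 2) := by
  have hk := continuous_kernel (d := d) hε hε'
  have hcont : Continuous (θ ⋆ kernel ε) := continuous_convolution (hθ.integrable one_le_two) hk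
  have hmem : MemLp (θ ⋆ kernel ε) 2 volume :=
    hcont.memLp_of_hasCompactSupport (HasCompactSupport.of_compactSpace _)
  have hY := eLpNorm_convolution_le (k := kernel ε) hθ.1 hk.aestronglyMeasurable one_le_two
  rw [lintegral_enorm_kernel hε hε', one_mul] at hY
  have h := ENNReal.toReal_mono hθ.2.ne hY
  rwa [torus_toReal_eLpNorm_two_eq_sqrt hmem, torus_toReal_eLpNorm_two_eq_sqrt hθ] at h

/-! ## Good times of a weak solution -/

omit [DecidableEq d] in
/-- **Slice facts at a.e. time.** Along a weak solution on `[0,T)` with integrable mean-zero datum,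
for a.e. `t ∈ (0,T)`: the mollified density `θ(t) ⋆ k_δ` is the datum `θ₀ ⋆ k_δ` plus the time
integral of the slice flux (the primitive identity of `PassiveScalarEnergyMollified`), the slice
has zero mean (the same identity with the constant kernel), lies in `L²`, and the slice
integrability of `PassiveScalarProofs` holds. [folklore] -/
theorem ae_seis_good {T κ : ℝ} {u : ℝ → UnitAddTorus d → EuclideanSpace ℝ d} {θ₀ : UnitAddTorus d → ℝ}
    {θ : ℝ → UnitAddTorus d → ℝ} (h : Torus.IsWeakScalarTransportOn T κ u θ₀ θ)
    (hθ₀i : Integrable θ₀ volume) (hθ₀0 : ∫ x, θ₀ x = 0) {δ : ℝ} (hδ : 0 < δ) (hδ4 : δ ≤ 1 / 4) :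
    ∀ᵐ t ∂((volume : Measure ℝ).restrict (Ioo 0 T)),
      (∀ x, (θ t ⋆ kernel δ) x = (θ₀ ⋆ kernel δ) x + ∫ σ in Ioc 0 t, sliceFlux δ κ (θ σ) (u σ) x) ∧
      ∫ x, θ t x = 0 ∧ MemLp (θ t) 2 volume ∧ Integrable (θ t) volume ∧
      AEStronglyMeasurable (u t) volume ∧ Integrable (fun y => ‖u t y‖ * θ t y) volume := by
  have hk := isSmooth_kernel (d := d) hδ hδ4
  have h1 : IsSmooth (fun _ : UnitAddTorus d => (1 : ℝ)) := isSmooth_const _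
  filter_upwards [h.ae_forall_molInt_eq_datum_add_setIntegral_flux hθ₀i hk,
    h.ae_forall_molInt_eq_datum_add_setIntegral_flux hθ₀i h1, h.ae_memLp_two, h.ae_slice_integrable₁]
    with t hprim hmean hmem hsl
  refine ⟨fun x => ?_, ?_, hmem, hsl.1, hsl.2.1, hsl.2.2⟩
  · rw [convolution_eq_molInt, convolution_eq_molInt, hprim x]
    rfl
  · have h0 := hmean 0
    simp only [mul_one, torusGradient_const, inner_zero_right, neg_zero, torusLaplacian_const,
      mul_zero, add_zero, integral_zero] at h0
    rw [h0, hθ₀0]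

/-! ## The concrete increment bound -/

/-- The transport constant `C_T = √(C_d · d)` (`C_d = twoPointL2Const d`). [folklore] -/
def seisCT (d : Type*) [Fintype d] [DecidableEq d] : ℝ :=
  Real.sqrt ((twoPointL2Const d).toReal * Fintype.card d)

/-- The diffusion constant `d · c₂` (`c₂ = derivProfileMass d 2`). [folklore] -/
def seisC2 (d : Type*) [Fintype d] : ℝ :=
  Fintype.card d * derivProfileMass d 2

/-- `0 ≤ C_T`. [folklore] -/
theorem seisCT_nonneg (d : Type*) [Fintype d] [DecidableEq d] : 0 ≤ seisCT d := Real.sqrt_nonneg _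

omit [DecidableEq d] in
/-- `0 ≤ d c₂`. [folklore] -/
theorem seisC2_nonneg (d : Type*) [Fintype d] : 0 ≤ seisC2 d :=
  mul_nonneg (Nat.cast_nonneg _) (derivProfileMass_nonneg (d := d) 2)

/-- **The increment bound along a weak solution (Seis 2022, §2.2, Lemma 3 integrated over
`[s, t]`, weak form with `δ² = κ`).** If `ρₛ` is a continuous mean-zero reference density with
`‖ρₛ‖₂ ≤ C₀`, `ρₜ - ρₛ` is the time integral over `(s,t]` of the slice flux of the solution at the
scale `δ`, and for a.e. `σ ∈ (s,t]` the slices obey `‖θ(σ)‖₂ ≤ C₀`, `∫‖u(σ)‖² ≤ Mv`,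
`eGradNormSq (u σ) < ∞` and `|θ(σ) ⋆ k_δ - ρₛ| ≤ S₀`, then
`krLogDist δ ρₛ - krLogDist δ ρₜ ≤ ∫_{(s,t]} (C₀ (C_T + √d) ‖∇u(σ)‖₂ + d c₂ C₀ + δ⁻¹ S₀ √Mv) dσ`.
[cite: Seis2022, Lemma 3 and proof of Thm 2, §2.2 (pp. 7–8)] -/
theorem krLogDist_sub_le_seis {δ κ : ℝ} (hδ : 0 < δ) (hδ4 : δ ≤ 1 / 4) (hκδ : κ = δ ^ 2)
    {θ : ℝ → UnitAddTorus d → ℝ} {u : ℝ → UnitAddTorus d → EuclideanSpace ℝ d}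
    {ρs ρt : UnitAddTorus d → ℝ} {s t C₀ Mv S₀ : ℝ} (hMv : 0 ≤ Mv) (hS₀ : 0 ≤ S₀)
    (hρs2 : MemLp ρs 2 volume) (hρsc : Continuous ρs) (hρs0 : ∫ x, ρs x = 0)
    (hρsC : Real.sqrt (∫ x, ρs x ^ 2) ≤ C₀) (hρt : Integrable ρt volume) (hρt0 : ∫ x, ρt x = 0)
    (hprim : ∀ x, ρt x - ρs x = ∫ σ in Ioc s t, sliceFlux δ κ (θ σ) (u σ) x)
    (hflm : AEStronglyMeasurable (uncurry fun σ x => sliceFlux δ κ (θ σ) (u σ) x)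
      (((volume : Measure ℝ).restrict (Ioc s t)).prod volume))
    {bound : ℝ → ℝ} (hbd : ∀ᵐ σ ∂((volume : Measure ℝ).restrict (Ioc s t)), ∀ x,
      ‖sliceFlux δ κ (θ σ) (u σ) x‖ ≤ bound σ) (hbi : IntegrableOn bound (Ioc s t))
    (hgood : ∀ᵐ σ ∂((volume : Measure ℝ).restrict (Ioc s t)), MemLp (θ σ) 2 volume ∧
      Real.sqrt (∫ x, θ σ x ^ 2) ≤ C₀ ∧ MemLp (u σ) 2 volume ∧ (∫⁻ x, ‖u σ x‖ₑ ^ 2 ≤ ENNReal.ofReal Mv) ∧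
      eGradNormSq (u σ) ≠ ∞ ∧ ∀ x, |(θ σ ⋆ kernel δ) x - ρs x| ≤ S₀)
    (hGi : IntegrableOn (fun σ => Real.sqrt (eGradNormSq (u σ)).toReal) (Ioc s t)) :
    krLogDist δ ρs - krLogDist δ ρt ≤ ∫ σ in Ioc s t,
      (C₀ * (seisCT d + Real.sqrt (Fintype.card d)) * Real.sqrt (eGradNormSq (u σ)).toReal +
        (seisC2 d * C₀ + δ⁻¹ * S₀ * Real.sqrt Mv)) := by
  set n : ℝ := (Fintype.card d : ℝ) with hn
  have hn0 : 0 ≤ n := Nat.cast_nonneg _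
  have hCT0 := seisCT_nonneg d
  have hmi : IntegrableOn (fun σ => C₀ * (seisCT d + Real.sqrt n) * Real.sqrt (eGradNormSq (u σ)).toReal +
      (seisC2 d * C₀ + δ⁻¹ * S₀ * Real.sqrt Mv)) (Ioc s t) :=
    (hGi.const_mul _).add (integrableOn_const (measure_Ioc_lt_top.ne))
  refine krLogDist_sub_le_of_sliceBound hδ (hρs2.integrable one_le_two) hρs0 hρt hρt0 hprim hflm hbd hbi hmi ?_
  filter_upwards [hgood] with σ hσ
  obtain ⟨hθ2, hθC, hu2, huM, hG, hSx⟩ := hσ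
  intro ζ hζ _ hopt
  have h := neg_integral_mul_sliceFlux_le hδ hδ hδ4 hθ2 hu2 hG hρs2 hρsc hρs0 hζ hopt hSx κ
  set G : ℝ := Real.sqrt (eGradNormSq (u σ)).toReal with hGdef
  have hG0 : 0 ≤ G := Real.sqrt_nonneg _
  -- term 1: transport
  have e1 : Real.sqrt ((twoPointL2Const d).toReal * (n * (eGradNormSq (u σ)).toReal)) = seisCT d * G := by
    rw [← mul_assoc, Real.sqrt_mul (mul_nonneg ENNReal.toReal_nonneg hn0), seisCT, hn]
  have t1 : Real.sqrt (∫ x, ρs x ^ 2) * Real.sqrt ((twoPointL2Const d).toReal * (n * (eGradNormSq (u σ)).toReal)) ≤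
      C₀ * (seisCT d * G) := by
    rw [e1]
    exact mul_le_mul_of_nonneg_right hρsC (mul_nonneg hCT0 hG0)
  -- term 2: commutator
  have t2 : δ⁻¹ * (Real.sqrt n * δ) * Real.sqrt (∫ x, θ σ x ^ 2) * G ≤ Real.sqrt n * C₀ * G := by
    have e : δ⁻¹ * (Real.sqrt n * δ) = Real.sqrt n := by field_simp
    rw [e]
    exact mul_le_mul_of_nonneg_right (mul_le_mul_of_nonneg_left hθC (Real.sqrt_nonneg _)) hG0
  -- term 3: mismatch
  have t3 : δ⁻¹ * S₀ * (∫ x, ‖u σ x‖) ≤ δ⁻¹ * S₀ * Real.sqrt Mv :=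
    mul_le_mul_of_nonneg_left (integral_norm_le_sqrt_of_lintegral_sq_le hu2 hMv huM)
      (mul_nonneg (inv_nonneg.2 hδ.le) hS₀)
  -- term 4: diffusion (`|κ| δ⁻¹ δ (d (δ²)⁻¹ c₂) = d c₂` since `κ = δ²`)
  have t4 : |κ| * (δ⁻¹ * δ * (n * ((δ ^ 2)⁻¹ * derivProfileMass d 2))) * (∫ x, |θ σ x|) ≤ seisC2 d * C₀ := by
    have e : |κ| * (δ⁻¹ * δ * (n * ((δ ^ 2)⁻¹ * derivProfileMass d 2))) = seisC2 d := by
      rw [hκδ, abs_of_pos (by positivity), seisC2, hn]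
      field_simp
    rw [e]
    exact mul_le_mul_of_nonneg_left ((integral_abs_le_sqrt_integral_sq hθ2).trans hθC) (seisC2_nonneg d)
  calc -∫ x, ζ x * sliceFlux δ κ (θ σ) (u σ) x ≤ _ := h
    _ ≤ C₀ * (seisCT d * G) + Real.sqrt n * C₀ * G + δ⁻¹ * S₀ * Real.sqrt Mv + seisC2 d * C₀ :=
        add_le_add (add_le_add (add_le_add t1 t2) t3) t4
    _ = C₀ * (seisCT d + Real.sqrt n) * G + (seisC2 d * C₀ + δ⁻¹ * S₀ * Real.sqrt Mv) := by ring

/-! ## More slice lemmas -/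

omit [DecidableEq d] in
/-- Young in `L¹` for the mollifier, real form: `∫ |θ ⋆ k_ε| ≤ ∫ |θ|`. [folklore] -/
theorem integral_abs_convolution_kernel_le {θ : UnitAddTorus d → ℝ} (hθ : Integrable θ volume)
    {ε : ℝ} (hε : 0 < ε) (hε' : ε ≤ 1 / 4) : ∫ x, |(θ ⋆ kernel ε) x| ≤ ∫ x, |θ x| := by
  have hk := continuous_kernel (d := d) hε hε'
  have hcont : Continuous (θ ⋆ kernel ε) := continuous_convolution hθ hk
  have hY := eLpNorm_convolution_le (k := kernel ε) hθ.1 hk.aestronglyMeasurable le_rfl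
  rw [lintegral_enorm_kernel hε hε', one_mul, eLpNorm_one_eq_lintegral_enorm, eLpNorm_one_eq_lintegral_enorm,
    ← ofReal_integral_norm_eq_lintegral_enorm hcont.integrable_unitAddTorus,
    ← ofReal_integral_norm_eq_lintegral_enorm hθ, ENNReal.ofReal_le_ofReal_iff (integral_nonneg fun x => norm_nonneg _)] at hY
  simpa [Real.norm_eq_abs] using hY

omit [DecidableEq d] in
/-- `√(x.toReal) = (x^{1/2}).toReal` in `[0, ∞]`. [folklore] -/
theorem sqrt_toReal_eq (x : ℝ≥0∞) : Real.sqrt x.toReal = (x ^ (1 / 2 : ℝ)).toReal := by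
  rw [Real.sqrt_eq_rpow, ENNReal.toReal_rpow]

omit [DecidableEq d] in
/-- A slice in `L²` from a bound on `∫⁻ ‖u‖ₑ²`. [folklore] -/
theorem memLp_two_of_lintegral_sq_le {u : UnitAddTorus d → EuclideanSpace ℝ d} (hu : AEStronglyMeasurable u volume)
    {Mv : ℝ} (h : ∫⁻ x, ‖u x‖ₑ ^ 2 ≤ ENNReal.ofReal Mv) : MemLp u 2 volume := by
  refine ⟨hu, ?_⟩
  rw [eLpNorm_eq_lintegral_rpow_enorm_toReal two_ne_zero ENNReal.ofNat_ne_top]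
  simp only [ENNReal.toReal_ofNat, ENNReal.rpow_two, one_div]
  exact ENNReal.rpow_lt_top_of_nonneg (by norm_num) (lt_of_le_of_lt h ENNReal.ofReal_lt_top).ne

/-! ## Constants of the core estimate -/

/-- The modulus constant `g = √d B + 1` of the datum. [folklore] -/
def seisMod (d : Type*) [Fintype d] (B : ℝ) : ℝ := Real.sqrt (Fintype.card d) * B + 1

omit [DecidableEq d] in
/-- `0 < g` for `B ≥ 0`. [folklore] -/
theorem seisMod_pos (d : Type*) [Fintype d] {B : ℝ} (hB : 0 ≤ B) : 0 < seisMod d B := by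
  unfold seisMod; positivity

/-- The chain constant `E₂ = C₀ (C_T + √d) M + d c₂ C₀`. [folklore] -/
def seisE2 (d : Type*) [Fintype d] [DecidableEq d] (C₀ M : ℝ) : ℝ :=
  C₀ * (seisCT d + Real.sqrt (Fintype.card d)) * M + seisC2 d * C₀

/-- `0 ≤ E₂`. [folklore] -/
theorem seisE2_nonneg (d : Type*) [Fintype d] [DecidableEq d] {C₀ M : ℝ} (hC₀ : 0 ≤ C₀) (hM : 0 ≤ M) :
    0 ≤ seisE2 d C₀ M := by
  unfold seisE2
  have := seisCT_nonneg d; have := seisC2_nonneg d; positivity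

/-! ## The core estimate -/

set_option maxHeartbeats 800000 in
/-- **The core of the proof of Seis 2022, Thm. 2 / Rmk. 1** (`p = q = r = 2`, `δ² = κ`,
`0 < D ≤ 1`): with the constants above and the dissipation horizon `T = (N+1)/D + 2`,
`(a/16) log(1 + x₀/(C_d δ)) - log(1 + 1/(2δ)) C₀ e^{-N} ≤ E₂ (1 + T) + 1`, `x₀ = min(a/(2g), 1)`
(lower endpoint: Lemma 4 at `ρ₀ = θ₀ ⋆ k_δ`; upper endpoint: the brutal estimate at a good time
`τ ∈ [N/D, N/D+1]`; in between: the chain of increments). [cite: Seis2022, proof of Thm 2, §2.2 (pp. 7–8)] -/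
theorem seis_core {a B C₀ M Mv : ℝ} (ha : 0 < a) (hB : 0 ≤ B) (hC₀ : 0 < C₀) (hM : 0 ≤ M) (hMv : 0 ≤ Mv)
    {κ D : ℝ} {u : ℝ → UnitAddTorus d → EuclideanSpace ℝ d} {θ₀ : UnitAddTorus d → ℝ}
    {θ : ℝ → UnitAddTorus d → ℝ} (hD : 0 < D) {δ : ℝ} (hδ : 0 < δ)
    (hκδ : κ = δ ^ 2) (hδ4 : δ ≤ 1 / 4) (hδa : δ ≤ a / (2 * seisMod d B))
    (hu2 : ∀ᵐ t ∂((volume : Measure ℝ).restrict (Ioi 0)), ∫⁻ x, ‖u t x‖ₑ ^ 2 ≤ ENNReal.ofReal Mv)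
    (hgrad : ∀ t : ℝ, 0 < t → ∫⁻ τ in Ioo 0 t, eGradNormSq (u τ) ^ (1 / 2 : ℝ) ≤ ENNReal.ofReal (M * (1 + t)))
    (hθ₀ : IsSmooth θ₀) (hθ₀0 : ∫ x, θ₀ x = 0) (ha' : a ≤ ∫ x, |θ₀ x|)
    (hB' : ∫ x, ‖Torus.gradient θ₀ x‖ ≤ B)
    (hsol : ∀ T : ℝ, 0 < T → Torus.IsWeakScalarTransportOn T κ u θ₀ θ)
    (hdecay : ∀ᵐ t ∂((volume : Measure ℝ).restrict (Ioi 0)),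
      Torus.scalarL2Sq (θ t) ≤ (C₀ * Real.exp (-(D * t))) ^ 2)
    (N : ℕ) :
    a / 16 * Real.log (1 + min (a / 2 / seisMod d B) 1 / (lemma4Const d * δ)) -
        Real.log (1 + 1 / (2 * δ)) * (C₀ * Real.exp (-(N : ℝ))) ≤
      seisE2 d C₀ M * (1 + (((N : ℝ) + 1) / D + 2)) + 1 := by
  classical
  -- the kernel and the reference density
  have hk : IsSmooth (kernel (d := d) δ) := isSmooth_kernel hδ hδ4
  have hkc : Continuous (kernel (d := d) δ) := continuous_kernel hδ hδ4
  have hki : Integrable (kernel (d := d) δ) volume := hkc.integrable_unitAddTorus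
  have hθ₀i : Integrable θ₀ volume := hθ₀.integrable
  have hg : 0 < seisMod d B := seisMod_pos d hB
  set n : ℝ := (Fintype.card d : ℝ) with hn
  set CT := seisCT d with hCT
  set c₂ := seisC2 d with hc₂
  set E₂ := seisE2 d C₀ M with hE₂
  have hCT0 : 0 ≤ CT := seisCT_nonneg d
  have hc₂0 : 0 ≤ c₂ := seisC2_nonneg d
  set L₀ := Real.log (1 + 1 / (2 * δ)) with hL₀
  have hL₀0 : 0 ≤ L₀ := log_one_add_inv_two_mul_nonneg hδ
  -- mean zero and norms of mollifications
  have hmean_conv : ∀ {f : UnitAddTorus d → ℝ}, Integrable f volume → ∫ x, f x = 0 →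
      ∫ x, (f ⋆ kernel δ) x = 0 := fun {f} hf hf0 => by
    rw [integral_convolution (L := ContinuousLinearMap.lsmul ℝ ℝ) hf hki]
    simp [hf0]
  set ρ₀ : UnitAddTorus d → ℝ := θ₀ ⋆ kernel δ with hρ₀
  have hρ₀c : Continuous ρ₀ := continuous_convolution hθ₀i hkc
  have hρ₀i : Integrable ρ₀ volume := hρ₀c.integrable_unitAddTorus
  have hρ₀0 : ∫ x, ρ₀ x = 0 := hmean_conv hθ₀i hθ₀0
  -- time horizon
  set T : ℝ := (((N : ℝ) + 1) / D + 2) with hT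
  have hNDpos : 0 ≤ ((N : ℝ) + 1) / D := by positivity
  have hT1 : 1 ≤ T := by linarith
  have hT0 : 0 < T := by linarith
  have hinvD : 0 ≤ (1 : ℝ) / D := by positivity
  have hND : (N : ℝ) / D + 1 ≤ T := by
    have e : T = (N : ℝ) / D + 1 / D + 2 := by rw [hT, add_div]
    rw [e]; linarith
  have hsolT := hsol T hT0
  -- the enstrophy rate `G`
  set Ge : ℝ → ℝ≥0∞ := fun t => eGradNormSq (u t) ^ (1 / 2 : ℝ) with hGe
  have hGem : AEMeasurable Ge ((volume : Measure ℝ).restrict (Ioo 0 T)) :=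
    (aemeasurable_eGradNormSq_slice hsolT.aestronglyMeasurable_uncurry_velocity).pow_const _
  have hGfin : ∫⁻ t in Ioo 0 T, Ge t ≠ ∞ := (lt_of_le_of_lt (hgrad T hT0) ENNReal.ofReal_lt_top).ne
  set G : ℝ → ℝ := fun t => (Ge t).toReal with hG
  have hGi : IntegrableOn G (Ioo 0 T) := integrable_toReal_of_lintegral_ne_top hGem hGfin
  have hG0 : ∀ t, 0 ≤ G t := fun t => ENNReal.toReal_nonneg
  have hGint : ∫ t in Ioo 0 T, G t ≤ M * (1 + T) := by
    rw [hG, integral_toReal hGem (ae_lt_top' hGem hGfin)]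
    exact ENNReal.toReal_le_of_le_ofReal (by positivity) (hgrad T hT0)
  have hGsqrt : ∀ t, Real.sqrt (eGradNormSq (u t)).toReal = G t := fun t => sqrt_toReal_eq _
  -- the flux bound
  obtain ⟨bound, hbi, hbd⟩ := hsolT.exists_flux_bound₁ hk
  have hbd' : ∀ᵐ σ ∂((volume : Measure ℝ).restrict (Ioo 0 T)), ∀ x,
      ‖sliceFlux δ κ (θ σ) (u σ) x‖ ≤ bound σ := hbd
  have hflmT : AEStronglyMeasurable (uncurry fun σ x => sliceFlux δ κ (θ σ) (u σ) x)
      (((volume : Measure ℝ).restrict (Ioo 0 T)).prod volume) := hsolT.aestronglyMeasurable_uncurry_flux₁ hk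
  have hflxi : ∀ x, IntegrableOn (fun σ => sliceFlux δ κ (θ σ) (u σ) x) (Ioo 0 T) := fun x =>
    (hsolT.integrable_mul_flux hk x).integral_prod_left
  -- the good set
  set S : Set ℝ := {t | t ∈ Ioo 0 T ∧
    (∀ x, (θ t ⋆ kernel δ) x = ρ₀ x + ∫ σ in Ioc 0 t, sliceFlux δ κ (θ σ) (u σ) x) ∧
    ∫ x, θ t x = 0 ∧ MemLp (θ t) 2 volume ∧ Integrable (θ t) volume ∧ AEStronglyMeasurable (u t) volume ∧
    Integrable (fun y => ‖u t y‖ * θ t y) volume ∧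
    Torus.scalarL2Sq (θ t) ≤ (C₀ * Real.exp (-(D * t))) ^ 2 ∧
    (∫⁻ x, ‖u t x‖ₑ ^ 2 ≤ ENNReal.ofReal Mv) ∧ Ge t < ∞} with hS
  have hSae : ∀ᵐ t ∂((volume : Measure ℝ).restrict (Ioo 0 T)), t ∈ S := by
    filter_upwards [ae_restrict_mem measurableSet_Ioo, ae_seis_good hsolT hθ₀i hθ₀0 hδ hδ4,
      ae_restrict_of_ae_restrict_of_subset Ioo_subset_Ioi_self hdecay,
      ae_restrict_of_ae_restrict_of_subset Ioo_subset_Ioi_self hu2, ae_lt_top' hGem hGfin]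
      with t ht hgood hdec hu hG
    exact ⟨ht, hgood.1, hgood.2.1, hgood.2.2.1, hgood.2.2.2.1, hgood.2.2.2.2.1, hgood.2.2.2.2.2, hdec, hu, hG⟩
  -- facts at good times
  have hS_sq : ∀ {t}, t ∈ S → Real.sqrt (∫ x, θ t x ^ 2) ≤ C₀ := fun {t} ht => by
    have h1 : Real.sqrt (∫ x, θ t x ^ 2) ≤ C₀ * Real.exp (-(D * t)) := by
      rw [← Real.sqrt_sq (by positivity : 0 ≤ C₀ * Real.exp (-(D * t)))]
      exact Real.sqrt_le_sqrt ht.2.2.2.2.2.2.2.1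
    refine h1.trans (mul_le_of_le_one_right hC₀.le ?_)
    exact Real.exp_le_one_iff.2 (by nlinarith [ht.1.1, hD])
  have hS_conv_c : ∀ {t}, t ∈ S → Continuous (θ t ⋆ kernel δ) := fun {t} ht => continuous_convolution ht.2.2.2.2.1 hkc
  have hS_conv0 : ∀ {t}, t ∈ S → ∫ x, (θ t ⋆ kernel δ) x = 0 := fun {t} ht => hmean_conv ht.2.2.2.2.1 ht.2.2.1
  have hS_u2 : ∀ {t}, t ∈ S → MemLp (u t) 2 volume := fun {t} ht => memLp_two_of_lintegral_sq_le ht.2.2.2.2.2.1 ht.2.2.2.2.2.2.2.2.1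
  have hS_eG : ∀ {t}, t ∈ S → eGradNormSq (u t) ≠ ∞ := fun {t} ht => by
    have h := ht.2.2.2.2.2.2.2.2.2
    simp only [hGe] at h
    exact (ENNReal.rpow_lt_top_iff_of_pos (by norm_num : (0 : ℝ) < 1 / 2)).1 h |>.ne
  -- differences of mollified slices are flux integrals
  have hdiff : ∀ {s t : ℝ}, (s = 0 ∨ s ∈ S) → t ∈ S → s ≤ t → ∀ x,
      (θ t ⋆ kernel δ) x - (if s = 0 then ρ₀ x else (θ s ⋆ kernel δ) x) =
        ∫ σ in Ioc s t, sliceFlux δ κ (θ σ) (u σ) x := by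
    intro s t hs ht hst x
    rcases hs with rfl | hs
    · simp only [if_true]
      rw [ht.2.1 x]; ring
    · have hs0 : s ≠ 0 := ne_of_gt hs.1.1
      rw [if_neg hs0, ht.2.1 x, hs.2.1 x]
      have hun : Ioc 0 t = Ioc 0 s ∪ Ioc s t := (Ioc_union_Ioc_eq_Ioc hs.1.1.le hst).symm
      have hIt : IntegrableOn (fun σ => sliceFlux δ κ (θ σ) (u σ) x) (Ioc 0 t) :=
        (hflxi x).mono_set (Ioc_subset_Ioo_right ht.1.2)
      rw [hun, setIntegral_union (Ioc_disjoint_Ioc_of_le le_rfl) measurableSet_Ioc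
        (hIt.mono_set (Ioc_subset_Ioc_right hst)) (hIt.mono_set (Ioc_subset_Ioc_left hs.1.1.le))]
      ring
  -- sup bound of flux integrals over short intervals: absolute continuity of `∫ bound`
  set Q : ℝ := δ⁻¹ * Real.sqrt Mv * T + L₀ + 1 with hQ
  have hQ0 : 0 < Q := by positivity
  set η : ℝ := 1 / (2 * Q) with hη
  have hη0 : 0 < η := by positivity
  have hηQ : Q * η = 1 / 2 := by rw [hη]; field_simp
  obtain ⟨δ', hδ'0, hδ'⟩ := exists_pos_setLIntegral_lt_of_measure_lt
    (μ := (volume : Measure ℝ).restrict (Ioo 0 T)) (f := fun t => ‖bound t‖ₑ) hbi.2.ne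
    (ENNReal.ofReal_pos.2 hη0).ne'
  set δ₁ : ℝ≥0∞ := min δ' 1 with hδ₁
  have hδ₁0 : δ₁ ≠ 0 := (lt_min hδ'0 zero_lt_one).ne'
  have hδ₁t : δ₁ ≠ ∞ := ne_top_of_le_ne_top ENNReal.one_ne_top (min_le_right _ _)
  set h : ℝ := δ₁.toReal / 2 with hh
  have hh0 : 0 < h := by have := ENNReal.toReal_pos hδ₁0 hδ₁t; rw [hh]; linarith
  -- `∫_{(s,t]} bound ≤ η` for `(s,t] ⊆ (0,T)` of length `≤ h`
  have hshort : ∀ {s t : ℝ}, 0 ≤ s → s ≤ t → t < T → t - s ≤ h → ∫ σ in Ioc s t, bound σ ≤ η := by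
    intro s t hs0 hst htT hts
    have hsub : Ioc s t ⊆ Ioo 0 T := fun σ hσ => ⟨hs0.trans_lt hσ.1, hσ.2.trans_lt htT⟩
    have hmeas : ((volume : Measure ℝ).restrict (Ioo 0 T)) (Ioc s t) < δ' := by
      rw [Measure.restrict_apply measurableSet_Ioc, Set.inter_eq_self_of_subset_left hsub, Real.volume_Ioc]
      calc ENNReal.ofReal (t - s) ≤ ENNReal.ofReal h := ENNReal.ofReal_le_ofReal hts
        _ < δ₁ := by
            refine (ENNReal.ofReal_lt_iff_lt_toReal hh0.le hδ₁t).2 ?_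
            rw [hh]; linarith [ENNReal.toReal_pos hδ₁0 hδ₁t]
        _ ≤ δ' := min_le_left _ _
    have hlt := hδ' (Ioc s t) hmeas
    rw [Measure.restrict_restrict_of_subset hsub] at hlt
    have hbi' : IntegrableOn bound (Ioc s t) := hbi.mono_set hsub
    calc ∫ σ in Ioc s t, bound σ ≤ ∫ σ in Ioc s t, ‖bound σ‖ := integral_mono hbi' hbi'.norm fun σ => Real.le_norm_self _
      _ = (∫⁻ σ in Ioc s t, ‖bound σ‖ₑ).toReal := integral_norm_eq_lintegral_enorm hbi'.aestronglyMeasurable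
      _ ≤ (ENNReal.ofReal η).toReal := ENNReal.toReal_mono ENNReal.ofReal_ne_top hlt.le
      _ = η := ENNReal.toReal_ofReal hη0.le
  -- flux integrals over short good intervals are `≤ η` pointwise
  have hflux_small : ∀ {s σ : ℝ}, 0 ≤ s → s ≤ σ → σ < T → σ - s ≤ h → ∀ x,
      |∫ r in Ioc s σ, sliceFlux δ κ (θ r) (u r) x| ≤ η := by
    intro s σ hs0 hsσ hσT hσs x
    have hsub : Ioc s σ ⊆ Ioo 0 T := fun r hr => ⟨hs0.trans_lt hr.1, hr.2.trans_lt hσT⟩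
    refine le_trans ?_ (hshort hs0 hsσ hσT hσs)
    rw [← Real.norm_eq_abs]
    exact norm_integral_le_of_norm_le (hbi.mono_set hsub)
      ((ae_restrict_of_ae_restrict_of_subset hsub hbd').mono fun r hr => hr x)
  -- a good time `τ ∈ [N/D, N/D+1)` and a good time `s₁ ≤ min h τ`
  have hND0 : 0 ≤ (N : ℝ) / D := by positivity
  obtain ⟨τ, hτS, hτI⟩ := exists_mem_of_ae_mem hSae hND0 (by linarith : (N : ℝ) / D < (N : ℝ) / D + 1) hND
  have hτ0 : 0 < τ := hτS.1.1
  have hτT : τ < T := hτS.1.2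
  obtain ⟨s₁, hs₁S, hs₁I⟩ := exists_mem_of_ae_mem hSae le_rfl (lt_min hh0 hτ0)
    ((min_le_right _ _).trans hτT.le)
  have hs₁0 : 0 < s₁ := hs₁S.1.1
  have hs₁h : s₁ ≤ h := (hs₁I.2.trans_le (min_le_left _ _)).le
  have hs₁τ : s₁ < τ := hs₁I.2.trans_le (min_le_right _ _)
  -- the chain of good times from `s₁` to `τ`
  obtain ⟨J, p, hJ, hp0, hpJ, hmono, hpS, hgap⟩ := exists_chain_mem hSae hs₁S hs₁0 hτS hs₁τ hτT hh0
  set Φ : ℝ → ℝ := fun t => krLogDist δ (θ t ⋆ kernel δ) with hΦ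
  set m : ℝ → ℝ := fun σ => C₀ * (CT + Real.sqrt n) * G σ + c₂ * C₀ with hm
  set c : ℝ := δ⁻¹ * η * Real.sqrt Mv with hc
  have hmono' : ∀ i j, i ≤ j → j ≤ J → p i ≤ p j := by
    intro i j hij hjJ
    induction j with
    | zero => simp [Nat.le_zero.1 hij]
    | succ j ih =>
      rcases Nat.lt_or_ge i (j + 1) with hlt | hge
      · exact (ih (Nat.lt_succ_iff.1 hlt) (Nat.le_of_succ_le hjJ)).trans (hmono j (Nat.lt_of_succ_le hjJ)).le
      · rw [le_antisymm hij hge]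
  have hpT : ∀ j, j ≤ J → p j < T := fun j hj => (hpS j hj).1.2
  have hp0' : ∀ j, j ≤ J → 0 < p j := fun j hj => (hpS j hj).1.1
  -- the increments
  have hinc : ∀ j, j < J → Φ (p j) - Φ (p (j + 1)) ≤
      (∫ σ in Ioc (p j) (p (j + 1)), m σ) + c * (p (j + 1) - p j) := by
    intro j hj
    have hsS := hpS j hj.le
    have htS := hpS (j + 1) (Nat.succ_le_of_lt hj)
    have hst : p j ≤ p (j + 1) := (hmono j hj).le
    have hsub : Ioc (p j) (p (j + 1)) ⊆ Ioo 0 T := fun σ hσ => ⟨(hp0' j hj.le).trans hσ.1, hσ.2.trans_lt (hpT _ (Nat.succ_le_of_lt hj))⟩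
    have hkey := krLogDist_sub_le_seis (d := d) hδ hδ4 hκδ (C₀ := C₀) (Mv := Mv) (S₀ := η) hMv hη0.le
      ((hS_conv_c hsS).memLp_of_hasCompactSupport (HasCompactSupport.of_compactSpace _)) (hS_conv_c hsS)
      (hS_conv0 hsS) ((sqrt_integral_sq_convolution_kernel_le hsS.2.2.2.1 hδ hδ4).trans (hS_sq hsS))
      (hS_conv_c htS).integrable_unitAddTorus (hS_conv0 htS)
      (fun x => by simpa [ne_of_gt hsS.1.1] using hdiff (Or.inr hsS) htS hst x)
      (hflmT.mono_measure (Measure.prod_mono (Measure.restrict_mono hsub le_rfl) le_rfl))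
      (ae_restrict_of_ae_restrict_of_subset hsub hbd') (hbi.mono_set hsub) ?_
      ((hGi.mono_set hsub).congr (Eventually.of_forall fun σ => (hGsqrt σ).symm))
    · -- conclude from `hkey`
      have hmi : IntegrableOn m (Ioc (p j) (p (j + 1))) :=
        (((hGi.mono_set hsub).const_mul _).add (integrableOn_const measure_Ioc_lt_top.ne))
      have e : ∫ σ in Ioc (p j) (p (j + 1)), (C₀ * (seisCT d + Real.sqrt (Fintype.card d)) *
          Real.sqrt (eGradNormSq (u σ)).toReal + (seisC2 d * C₀ + δ⁻¹ * η * Real.sqrt Mv)) =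
          (∫ σ in Ioc (p j) (p (j + 1)), m σ) + c * (p (j + 1) - p j) := by
        have e1 : ∀ σ, C₀ * (seisCT d + Real.sqrt (Fintype.card d)) * Real.sqrt (eGradNormSq (u σ)).toReal +
            (seisC2 d * C₀ + δ⁻¹ * η * Real.sqrt Mv) = m σ + c := fun σ => by
          simp only [hm, hc, hGsqrt, hCT, hc₂, hn]; ring
        simp_rw [e1]
        rw [integral_add hmi (integrableOn_const measure_Ioc_lt_top.ne), setIntegral_const,
          Real.volume_real_Ioc_of_le hst, smul_eq_mul, mul_comm]
      rw [e] at hkey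
      exact hkey
    · -- the slice facts on `(p j, p (j+1)]`
      filter_upwards [ae_restrict_mem measurableSet_Ioc,
        ae_restrict_of_ae_restrict_of_subset hsub hSae] with σ hσI hσS
      refine ⟨hσS.2.2.2.1, hS_sq hσS, hS_u2 hσS, hσS.2.2.2.2.2.2.2.2.1, hS_eG hσS, fun x => ?_⟩
      have e := hdiff (Or.inr hsS) hσS hσI.1.le x
      simp only [ne_of_gt hsS.1.1, if_false] at e
      rw [e]
      exact hflux_small (hp0' j hj.le).le hσI.1.le hσS.1.2 (by linarith [hσI.2, hgap j hj]) x
  -- the chain estimate `Φ s₁ - Φ τ ≤ ∫_{(s₁,τ]} m + c (τ - s₁)`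
  have hsub1 : Ioc s₁ τ ⊆ Ioo 0 T := fun σ hσ => ⟨hs₁0.trans hσ.1, hσ.2.trans_lt hτT⟩
  have hmiT : IntegrableOn m (Ioc (p 0) (p J)) := by
    rw [hp0, hpJ]
    exact ((hGi.mono_set hsub1).const_mul _).add (integrableOn_const measure_Ioc_lt_top.ne)
  have hchain := sub_le_integral_add_of_chain (fun j hj => (hmono j hj).le) hmiT hinc
  rw [hp0, hpJ] at hchain
  -- `∫_{(s₁,τ]} m ≤ C₀ (C_T + √d) M (1+T) + d c₂ C₀ T`
  have hIm : ∫ σ in Ioc s₁ τ, m σ ≤ C₀ * (CT + Real.sqrt n) * (M * (1 + T)) + c₂ * C₀ * T := by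
    have hGI : ∫ σ in Ioc s₁ τ, G σ ≤ M * (1 + T) :=
      (setIntegral_mono_set hGi (Eventually.of_forall hG0) (Eventually.of_forall hsub1)).trans hGint
    simp only [hm]
    rw [integral_add ((hGi.mono_set hsub1).const_mul _) (integrableOn_const measure_Ioc_lt_top.ne),
      integral_const_mul, setIntegral_const, Real.volume_real_Ioc_of_le hs₁τ.le, smul_eq_mul]
    have h1 : C₀ * (CT + Real.sqrt n) * ∫ σ in Ioc s₁ τ, G σ ≤ C₀ * (CT + Real.sqrt n) * (M * (1 + T)) :=
      mul_le_mul_of_nonneg_left hGI (by positivity)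
    have h2 : (τ - s₁) * (c₂ * C₀) ≤ T * (c₂ * C₀) := mul_le_mul_of_nonneg_right (by linarith) (by positivity)
    linarith
  -- the two small errors
  have hQ1 : δ⁻¹ * Real.sqrt Mv * T ≤ Q := by rw [hQ]; linarith
  have hQ2 : L₀ ≤ Q := by
    have h0 : 0 ≤ δ⁻¹ * Real.sqrt Mv * T := by positivity
    rw [hQ]; linarith
  have hcT : c * (τ - s₁) ≤ 1 / 2 := by
    calc c * (τ - s₁) ≤ c * T := mul_le_mul_of_nonneg_left (by linarith) (by positivity)
      _ = η * (δ⁻¹ * Real.sqrt Mv * T) := by rw [hc]; ring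
      _ ≤ η * Q := mul_le_mul_of_nonneg_left hQ1 hη0.le
      _ = 1 / 2 := by rw [mul_comm, hηQ]
  have hstart : krLogDist δ ρ₀ - Φ s₁ ≤ 1 / 2 := by
    have hε : ∀ x, |ρ₀ x - (θ s₁ ⋆ kernel δ) x| ≤ η := fun x => by
      have e := hdiff (Or.inl rfl) hs₁S hs₁0.le x
      simp only [if_true] at e
      rw [abs_sub_comm, e]
      exact hflux_small le_rfl hs₁0.le hs₁S.1.2 (by linarith) x
    have h1 := krLogDist_le_krLogDist_add_of_abs_sub_le hδ hρ₀i hρ₀0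
      (hS_conv_c hs₁S).integrable_unitAddTorus (hS_conv0 hs₁S) hε
    have h2 : L₀ * η ≤ 1 / 2 := by
      calc L₀ * η ≤ Q * η := mul_le_mul_of_nonneg_right hQ2 hη0.le
        _ = 1 / 2 := hηQ
    show krLogDist δ ρ₀ - krLogDist δ (θ s₁ ⋆ kernel δ) ≤ 1 / 2
    linarith
  have hE : C₀ * (CT + Real.sqrt n) * (M * (1 + T)) + c₂ * C₀ * T ≤ E₂ * (1 + T) := by
    have e : E₂ * (1 + T) = C₀ * (CT + Real.sqrt n) * (M * (1 + T)) + c₂ * C₀ * (1 + T) := by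
      rw [hE₂, seisE2, ← hCT, ← hn, ← hc₂]; ring
    rw [e]
    have h0 : 0 ≤ c₂ * C₀ := by positivity
    have h1 : c₂ * C₀ * T ≤ c₂ * C₀ * (1 + T) := mul_le_mul_of_nonneg_left (by linarith) h0
    linarith
  have hupper_chain : krLogDist δ ρ₀ - Φ τ ≤ E₂ * (1 + T) + 1 := by linarith [hstart, hchain, hIm, hcT, hE]
  -- lower endpoint: Lemma 4 at `ρ₀ = θ₀ ⋆ k_δ`
  have hgB : Real.sqrt (Fintype.card d) * (∫ z, ‖Torus.gradient θ₀ z‖) ≤ seisMod d B := by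
    rw [seisMod]
    have h1 : Real.sqrt (Fintype.card d) * (∫ z, ‖Torus.gradient θ₀ z‖) ≤ Real.sqrt (Fintype.card d) * B :=
      mul_le_mul_of_nonneg_left hB' (Real.sqrt_nonneg _)
    linarith
  have hmodθ₀ : ∀ y, eLpNorm (fun x => θ₀ (x - y) - θ₀ x) 1 volume ≤ ENNReal.ofReal (seisMod d B * ‖y‖) :=
    fun y => eLpNorm_translate_sub_le_integral_norm_gradient (hθ₀.isContDiff (by simp)) hgB y
  have hmodρ₀ : ∀ y, eLpNorm (fun x => ρ₀ (x - y) - ρ₀ x) 1 volume ≤ ENNReal.ofReal (seisMod d B * ‖y‖) :=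
    fun y => (eLpNorm_sub_translate_convolution_kernel_le hθ₀i hδ hδ4 y).trans (hmodθ₀ y)
  have hm₀ : a / 2 ≤ ∫ x, |ρ₀ x| := by
    have h1 : ∫ x, |ρ₀ x - θ₀ x| ≤ seisMod d B * δ :=
      integral_abs_convolution_kernel_sub_self_le hθ₀i hg.le hmodθ₀ hδ hδ4
    have hi2 : Integrable (fun x => |ρ₀ x - θ₀ x|) volume := (hρ₀i.sub hθ₀i).abs
    have h2 : ∫ x, |θ₀ x| ≤ (∫ x, |ρ₀ x|) + ∫ x, |ρ₀ x - θ₀ x| := by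
      rw [← integral_add hρ₀i.abs hi2]
      refine integral_mono hθ₀i.abs (hρ₀i.abs.add hi2) fun x => ?_
      have := abs_sub_abs_le_abs_sub (θ₀ x) (ρ₀ x)
      rw [abs_sub_comm] at this
      linarith
    have h3 : seisMod d B * δ ≤ a / 2 := by
      rw [le_div_iff₀ (by positivity)] at hδa
      linarith
    linarith
  have hlower : a / 16 * Real.log (1 + min (a / 2 / seisMod d B) 1 / (lemma4Const d * δ)) ≤ krLogDist δ ρ₀ := by
    have hL4 := krLogDist_ge_of_translation hδ hρ₀i hρ₀c.measurable hρ₀0 hg hmodρ₀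
    set m₀ : ℝ := ∫ x, |ρ₀ x| with hm₀def
    -- monotonicity in `m₀ ≥ a/2`
    have hx : min (a / 2 / seisMod d B) 1 ≤ min (m₀ / seisMod d B) 1 :=
      min_le_min (div_le_div_of_nonneg_right hm₀ hg.le) le_rfl
    have hx0 : 0 ≤ min (a / 2 / seisMod d B) 1 := le_min (by positivity) zero_le_one
    have hlog0 : 0 ≤ Real.log (1 + min (a / 2 / seisMod d B) 1 / (lemma4Const d * δ)) :=
      Real.log_nonneg (by
        have : 0 ≤ min (a / 2 / seisMod d B) 1 / (lemma4Const d * δ) :=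
          div_nonneg hx0 (mul_nonneg (lemma4Const_nonneg d) hδ.le)
        linarith)
    have hlogmono : Real.log (1 + min (a / 2 / seisMod d B) 1 / (lemma4Const d * δ)) ≤
        Real.log (1 + min (m₀ / seisMod d B) 1 / (lemma4Const d * δ)) := by
      refine Real.log_le_log (by
        have : 0 ≤ min (a / 2 / seisMod d B) 1 / (lemma4Const d * δ) :=
          div_nonneg hx0 (mul_nonneg (lemma4Const_nonneg d) hδ.le)
        linarith) ?_
      linarith [div_le_div_of_nonneg_right hx (mul_nonneg (lemma4Const_nonneg d) hδ.le)]
    calc a / 16 * Real.log (1 + min (a / 2 / seisMod d B) 1 / (lemma4Const d * δ))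
        ≤ m₀ / 8 * Real.log (1 + min (m₀ / seisMod d B) 1 / (lemma4Const d * δ)) :=
          mul_le_mul (by linarith) hlogmono hlog0 (by linarith)
      _ ≤ krLogDist δ ρ₀ := hL4
  -- upper endpoint: brutal estimate at `τ`
  have hupper : Φ τ ≤ L₀ * (C₀ * Real.exp (-(N : ℝ))) := by
    have h1 : Φ τ ≤ L₀ * ∫ x, |(θ τ ⋆ kernel δ) x| :=
      krLogDist_le hδ (hS_conv_c hτS).integrable_unitAddTorus (hS_conv0 hτS)
    have h2 : ∫ x, |(θ τ ⋆ kernel δ) x| ≤ C₀ * Real.exp (-(D * τ)) := by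
      refine (integral_abs_convolution_kernel_le hτS.2.2.2.2.1 hδ hδ4).trans ?_
      refine (integral_abs_le_sqrt_integral_sq hτS.2.2.2.1).trans ?_
      rw [← Real.sqrt_sq (by positivity : 0 ≤ C₀ * Real.exp (-(D * τ)))]
      exact Real.sqrt_le_sqrt hτS.2.2.2.2.2.2.2.1
    have h3 : Real.exp (-(D * τ)) ≤ Real.exp (-(N : ℝ)) := by
      refine Real.exp_le_exp.2 (neg_le_neg ?_)
      have := hτI.1.le
      rw [div_le_iff₀ hD] at this
      linarith
    have h4 : C₀ * Real.exp (-(D * τ)) ≤ C₀ * Real.exp (-(N : ℝ)) := mul_le_mul_of_nonneg_left h3 hC₀.le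
    calc Φ τ ≤ L₀ * ∫ x, |(θ τ ⋆ kernel δ) x| := h1
      _ ≤ L₀ * (C₀ * Real.exp (-(N : ℝ))) := mul_le_mul_of_nonneg_left (h2.trans h4) hL₀0
  linarith

/-! ## The degenerate dimension -/

omit [DecidableEq d] in
/-- In dimension zero a mean-zero function vanishes, so `∫ |θ₀| = 0`. [folklore] -/
theorem integral_abs_eq_zero_of_isEmpty [IsEmpty d] {θ₀ : UnitAddTorus d → ℝ} (h0 : ∫ x, θ₀ x = 0) :
    ∫ x, |θ₀ x| = 0 := by
  have hc : θ₀ = fun _ => θ₀ 0 := funext fun x => congrArg θ₀ (Subsingleton.elim x 0)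
  have hval : θ₀ 0 = 0 := by
    rw [hc, integral_const, smul_eq_mul] at h0
    simpa using h0
  rw [hc]
  simp [hval]

/-! ## The real-variable endgame -/

/-- **Endgame algebra.** If `0 < D ≤ 1`, `0 < δ ≤ 1/4`, `C₄ > 0`, `x₀ > 0`, `C₀ e^{-N} ≤ a/32` and
the core inequality holds, then `(a/32) log(1/δ) - (a/16)|log(x₀/C₄)| ≤ (E₂ (N+4) + 1)/D`. [folklore] -/
theorem endgame_algebra {a C₀ C₄ x₀ E₂ D δ : ℝ} {N : ℕ} (ha : 0 < a) (hC₀ : 0 < C₀) (hC₄ : 0 < C₄)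
    (hx₀ : 0 < x₀) (hE₂ : 0 ≤ E₂) (hD : 0 < D) (hD1 : D ≤ 1) (hδ : 0 < δ) (hδ2 : δ ≤ 1 / 4)
    (hN : C₀ * Real.exp (-(N : ℝ)) ≤ a / 32)
    (hcore : a / 16 * Real.log (1 + x₀ / (C₄ * δ)) - Real.log (1 + 1 / (2 * δ)) * (C₀ * Real.exp (-(N : ℝ))) ≤
      E₂ * (1 + (((N : ℝ) + 1) / D + 2)) + 1) :
    a / 32 * Real.log δ⁻¹ - a / 16 * |Real.log (x₀ / C₄)| ≤ (E₂ * ((N : ℝ) + 4) + 1) / D := by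
  have hℓ0 : 0 ≤ Real.log δ⁻¹ := Real.log_nonneg (by rw [le_inv_comm₀ one_pos hδ, inv_one]; linarith)
  -- `log(1 + x₀/(C₄ δ)) ≥ log δ⁻¹ + log (x₀/C₄)`
  have h1 : Real.log δ⁻¹ + Real.log (x₀ / C₄) ≤ Real.log (1 + x₀ / (C₄ * δ)) := by
    rw [← Real.log_mul (inv_ne_zero hδ.ne') (div_pos hx₀ hC₄).ne']
    refine Real.log_le_log (mul_pos (inv_pos.2 hδ) (div_pos hx₀ hC₄)) ?_
    have e : δ⁻¹ * (x₀ / C₄) = x₀ / (C₄ * δ) := by field_simp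
    rw [e]; linarith
  -- `log(1 + 1/(2δ)) ≤ log δ⁻¹`
  have h2 : Real.log (1 + 1 / (2 * δ)) ≤ Real.log δ⁻¹ := by
    refine Real.log_le_log (by positivity) ?_
    rw [← one_div, le_div_iff₀ hδ]
    have : 1 / (2 * δ) * δ = 1 / 2 := by field_simp
    nlinarith
  -- the right-hand side for `D ≤ 1`
  have h3 : E₂ * (1 + (((N : ℝ) + 1) / D + 2)) + 1 ≤ (E₂ * ((N : ℝ) + 4) + 1) / D := by
    rw [le_div_iff₀ hD]
    have e : (E₂ * (1 + (((N : ℝ) + 1) / D + 2)) + 1) * D = E₂ * (3 * D + ((N : ℝ) + 1)) + D := by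
      field_simp
      ring
    rw [e]
    have : E₂ * (3 * D + ((N : ℝ) + 1)) ≤ E₂ * ((N : ℝ) + 4) := mul_le_mul_of_nonneg_left (by linarith) hE₂
    linarith
  have habs : -|Real.log (x₀ / C₄)| ≤ Real.log (x₀ / C₄) := neg_abs_le _
  have h4 : Real.log (1 + 1 / (2 * δ)) * (C₀ * Real.exp (-(N : ℝ))) ≤ Real.log δ⁻¹ * (a / 32) :=
    mul_le_mul h2 hN (by positivity) hℓ0
  have h5 : a / 16 * (Real.log δ⁻¹ + Real.log (x₀ / C₄)) ≤ a / 16 * Real.log (1 + x₀ / (C₄ * δ)) :=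
    mul_le_mul_of_nonneg_left h1 (by positivity)
  nlinarith

/-! ## The discharges -/

/-- **Seis 2022, Remark 1 (case `p = q = r = 2`) holds.** [cite: Seis2022, Rmk 1 (p. 4), proof §2.2] -/
theorem Seis2022_rmk1_L2_holds : Seis2022_rmk1_L2 := by
  intro d _ _ a b B C₀ M ha hC₀ hM
  classical
  -- constants
  set g : ℝ := seisMod d (max B 0) with hg
  have hg0 : 0 < g := seisMod_pos d (le_max_right _ _)
  set x₀ : ℝ := min (a / 2 / g) 1 with hx₀
  have hx₀0 : 0 < x₀ := lt_min (by positivity) one_pos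
  set C₄ : ℝ := lemma4Const d with hC₄
  set N : ℕ := ⌈Real.log (32 * C₀ / a)⌉₊ with hN
  set E₂ : ℝ := seisE2 d C₀ M with hE₂
  have hE₂0 : 0 ≤ E₂ := seisE2_nonneg d hC₀.le hM
  set E₁ : ℝ := a / 16 * |Real.log (x₀ / C₄)| with hE₁
  have hE₁0 : 0 ≤ E₁ := by positivity
  set K : ℝ := 128 * (E₂ * ((N : ℝ) + 4) + 1) / a with hK
  have hK0 : 0 ≤ K := by positivity
  set κ₀ : ℝ := min (min (1 / 16) ((a / (2 * g)) ^ 2)) (min (Real.exp (-(128 * E₁ / a))) (Real.exp (-(K + 1)))) with hκ₀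
  have hκ₀0 : 0 < κ₀ := lt_min (lt_min (by norm_num) (by positivity)) (lt_min (Real.exp_pos _) (Real.exp_pos _))
  have hκ₀1 : κ₀ < 1 := (min_le_left _ _).trans_lt ((min_le_left _ _).trans_lt (by norm_num))
  refine ⟨κ₀, K, hκ₀0, hκ₀1, hK0, ?_⟩
  intro κ D u θ₀ θ hκ hκκ₀ hu2 hgrad hθ₀ hmean ha' _ hB' hsol hdecay
  -- facts about `κ`
  have hκ16 : κ ≤ 1 / 16 := hκκ₀.trans ((min_le_left _ _).trans (min_le_left _ _))
  have hκa : κ ≤ (a / (2 * g)) ^ 2 := hκκ₀.trans ((min_le_left _ _).trans (min_le_right _ _))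
  have hκE₁ : κ ≤ Real.exp (-(128 * E₁ / a)) := hκκ₀.trans ((min_le_right _ _).trans (min_le_left _ _))
  have hκK : κ ≤ Real.exp (-(K + 1)) := hκκ₀.trans ((min_le_right _ _).trans (min_le_right _ _))
  have hlogκ : 0 < Real.log κ⁻¹ := Real.log_pos (by rw [lt_inv_comm₀ one_pos hκ, inv_one]; linarith)
  have hlog_ge : ∀ {y : ℝ}, κ ≤ Real.exp (-y) → y ≤ Real.log κ⁻¹ := fun {y} hy => by
    rw [Real.log_inv, le_neg, ← Real.log_exp (-y)]
    exact Real.log_le_log hκ hy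
  -- trivial case `D ≤ 0`
  by_cases hD0 : D ≤ 0
  · exact hD0.trans (div_nonneg hK0 hlogκ.le)
  push Not at hD0
  -- degenerate dimension
  rcases isEmpty_or_nonempty d with hd | hd
  · exfalso
    have := integral_abs_eq_zero_of_isEmpty (d := d) hmean
    linarith
  have hC₄0 : 0 < C₄ := lemma4Const_pos
  -- `δ = √κ`
  set δ : ℝ := Real.sqrt κ with hδdef
  have hδ : 0 < δ := Real.sqrt_pos.2 hκ
  have hκδ : κ = δ ^ 2 := (Real.sq_sqrt hκ.le).symm
  have hδ4 : δ ≤ 1 / 4 := by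
    rw [hδdef, show (1 / 4 : ℝ) = Real.sqrt (1 / 16) by
      rw [show (1 / 16 : ℝ) = (1 / 4) ^ 2 by norm_num, Real.sqrt_sq (by norm_num)]]
    exact Real.sqrt_le_sqrt hκ16
  have hδa : δ ≤ a / (2 * g) := by
    rw [hδdef, ← Real.sqrt_sq (by positivity : 0 ≤ a / (2 * g))]
    exact Real.sqrt_le_sqrt hκa
  have hlogδ : Real.log δ⁻¹ = Real.log κ⁻¹ / 2 := by
    rw [Real.log_inv, Real.log_inv, hδdef, Real.log_sqrt hκ.le]; ring
  -- `N`
  have hN' : C₀ * Real.exp (-(N : ℝ)) ≤ a / 32 := by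
    have h1 : Real.log (32 * C₀ / a) ≤ N := Nat.le_ceil _
    have h2 : 32 * C₀ / a ≤ Real.exp (N : ℝ) := by
      rw [← Real.exp_log (by positivity : 0 < 32 * C₀ / a)]
      exact Real.exp_le_exp.2 h1
    have hpos := Real.exp_pos (N : ℝ)
    rw [div_le_iff₀ ha] at h2
    rw [Real.exp_neg, le_div_iff₀ (by norm_num : (0 : ℝ) < 32),
      show C₀ * (Real.exp (N : ℝ))⁻¹ * 32 = (32 * C₀) / Real.exp (N : ℝ) by ring, div_le_iff₀ hpos]
    linarith [h2, mul_comm (Real.exp (N : ℝ)) a]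
  -- data facts
  obtain ⟨M', hM'⟩ := hu2
  have hu2' : ∀ᵐ t ∂((volume : Measure ℝ).restrict (Ioi 0)), ∫⁻ x, ‖u t x‖ₑ ^ 2 ≤ ENNReal.ofReal (M' : ℝ) := by
    simpa only [ENNReal.ofReal_coe_nnreal] using hM'
  have hB'' : ∫ x, ‖Torus.gradient θ₀ x‖ ≤ max B 0 := hB'.trans (le_max_left _ _)
  -- the core at rate `min D 1`
  have hcore : ∀ {D' : ℝ}, 0 < D' → D' ≤ D →
      a / 32 * Real.log δ⁻¹ - E₁ ≤ (E₂ * ((N : ℝ) + 4) + 1) / D' ∨ 1 < D' := by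
    intro D' hD' hD'D
    by_cases hD'1 : D' ≤ 1
    · left
      have hdecay' : ∀ᵐ t ∂((volume : Measure ℝ).restrict (Ioi 0)),
          Torus.scalarL2Sq (θ t) ≤ (C₀ * Real.exp (-(D' * t))) ^ 2 := by
        filter_upwards [hdecay, ae_restrict_mem measurableSet_Ioi] with t ht ht0
        refine ht.trans (pow_le_pow_left₀ (by positivity) (mul_le_mul_of_nonneg_left
          (Real.exp_le_exp.2 (neg_le_neg (mul_le_mul_of_nonneg_right hD'D (le_of_lt ht0)))) hC₀.le) 2)
      have h := seis_core (d := d) ha (le_max_right B 0) hC₀ hM (NNReal.coe_nonneg M') hD' hδ hκδ hδ4 hδa hu2' hgrad hθ₀ hmean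
        ha' hB'' hsol hdecay' N
      exact endgame_algebra ha hC₀ hC₄0 hx₀0 hE₂0 hD' hD'1 hδ hδ4 hN' h
    · right; exact not_le.1 hD'1
  -- conclusion
  set m : ℝ := min D 1 with hm
  have hm0 : 0 < m := lt_min hD0 one_pos
  have hmain : a / 32 * Real.log δ⁻¹ - E₁ ≤ (E₂ * ((N : ℝ) + 4) + 1) / m := by
    rcases hcore hm0 (min_le_left _ _) with h | h
    · exact h
    · exact absurd (min_le_right D 1) (not_le.2 h)
  have hℓE₁ : 128 * E₁ / a ≤ Real.log κ⁻¹ := hlog_ge hκE₁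
  have hℓK : K + 1 ≤ Real.log κ⁻¹ := hlog_ge hκK
  have hkey : m * Real.log κ⁻¹ ≤ K := by
    rw [hlogδ] at hmain
    have h1 : E₁ ≤ a / 128 * Real.log κ⁻¹ := by
      rw [div_le_iff₀ ha] at hℓE₁; linarith
    have h2 : a / 128 * Real.log κ⁻¹ ≤ (E₂ * ((N : ℝ) + 4) + 1) / m := by linarith
    rw [le_div_iff₀ hm0] at h2
    rw [hK, le_div_iff₀ ha]
    nlinarith
  by_cases hD1 : D ≤ 1
  · rw [hm, min_eq_left hD1] at hkey
    rw [le_div_iff₀ hlogκ]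
    exact hkey
  · exfalso
    rw [hm, min_eq_right (le_of_not_ge hD1), one_mul] at hkey
    linarith

/-- **Seis 2022, Theorem 2 (case `p = q = r = 2`, every weak solution) holds**: the special
case `M = 1` of Remark 1 (`‖∇u(t)‖₂ ≤ 1` a.e. gives `∫₀ᵗ ‖∇u‖₂ ≤ t ≤ 1 + t`).
[cite: Seis2022, Thm 2 (pp. 3–4), proof §2.2] -/
theorem Seis2022_thm2_L2_holds : Seis2022_thm2_L2 := by
  intro d _ _ a b B C₀ ha hC₀
  obtain ⟨κ₀, K, h0, h1, hK, h⟩ := Seis2022_rmk1_L2_holds (d := d) a b B C₀ 1 ha hC₀ zero_le_one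
  refine ⟨κ₀, K, h0, h1, hK, fun κ D u θ₀ θ hκ hκ₀ hu2 hgrad hθ₀ hmean ha' hb hB hsol hdecay =>
    h κ D u θ₀ θ hκ hκ₀ hu2 (fun t ht => ?_) hθ₀ hmean ha' hb hB hsol hdecay⟩
  calc ∫⁻ τ in Ioo 0 t, eGradNormSq (u τ) ^ (1 / 2 : ℝ) ≤ ∫⁻ _τ in Ioo 0 t, (1 : ℝ≥0∞) := by
        refine lintegral_mono_ae ((ae_restrict_of_ae_restrict_of_subset Ioo_subset_Ioi_self hgrad).mono
          fun τ hτ => ?_)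
        calc eGradNormSq (u τ) ^ (1 / 2 : ℝ) ≤ (1 : ℝ≥0∞) ^ (1 / 2 : ℝ) := ENNReal.rpow_le_rpow hτ (by norm_num)
          _ = 1 := ENNReal.one_rpow _
    _ = ENNReal.ofReal t := by rw [setLIntegral_one, Real.volume_Ioo, sub_zero]
    _ ≤ ENNReal.ofReal (1 * (1 + t)) := ENNReal.ofReal_le_ofReal (by linarith)

end Literature.Analysis.FluidPDE
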